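import Mathlib
import HarnessLib
import Summits.NavierStokesRegularity.NavierStokesRegularity.Theorems.TypeILiouvilleShorelineLocalSymmetry
import Literature.Analysis.FluidPDE.CurlFreeLiouville
import Literature.Analysis.FluidPDE.GigaMiura2011ScaledAlignmentBlowupLimitHolds

/-!
# TypeILiouvilleShorelineSectors — crux (L) stmt-NavierStokesRegularity-10661 `TypeIliouvilleL`:
# LOCALLY IRROTATIONAL ANYWHERE ⟹ TRIVIAL; LOCALLY TRANSLATION-INVARIANT ANYWHERE ⟹ A 2½-D FLOW

Helper for stmt-NavierStokesRegularity-10661 (`--supports`); theorems only, no definitions, no named-fact hypotheses;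
closes no item; Navier–Stokes regularity is NOT proved here (leafhand seat of the EulerZoomLiouville route; sequel to
`TypeILiouvilleShorelineAnalytic/Continuation/LocalSymmetry`).  Class P = print's class of bounded ancient mild
solutions (continuous and bounded on `(−∞,0) × ℝ³`, weakly divergence free, Oseen integral equation).

* `classP_curl_analyticOnNhd_slice` — the vorticity of a class-P slice is real-analytic on `ℝ³`.
* `classP_const_of_locallyIrrotational` — **A NEW PROVED SECTOR OF (L)**: a class-P flow whose vorticity vanishes on
  ONE nonempty open set of ONE slice `t₀ < 0` is one constant vector (analytic vorticity ⟹ the slice is curl-free;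
  curl-free + div-free + bounded ⟹ constant slice, `eq_of_curl_eq_zero_of_isDivFree_of_bounded`; one-slice rigidity).
  Every would-be counterexample to (L) is therefore ROTATIONAL EVERYWHERE: `curl v(t,·)` has no open zero set at any time.
* `classP_translationInvariant_of_locally` — a class-P flow with `v t₀ (x + s•e) = v t₀ x` for `x` in one open patch and
  all `|s| < δ` is invariant under EVERY translation along `e` at EVERY time (`s ↦ v t (x + s•e)` is analytic and locally
  constant): the member is a 2½-dimensional flow, i.e. it sits on the KNSS-Theorem-5.1 wall (bounded ancient 2-D flows
  are `b(t)`; the mild-class 2½-D reduction is not carried out here).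
* `classP_const_of_curl_eq_zero_outside_ball` — vorticity vanishing outside a ball at one time (e.g. compactly supported)
  ⟹ constant.
[cite: LemarieRieusset2016, Thm. 9.12 (PDF p. 260); KochNadirashviliSereginSverak2009, Thm. 5.1 and §4 (arXiv:0709.3599)]
-/

noncomputable section
open MeasureTheory Filter Set Function Metric
open scoped Topology ENNReal
open Literature.Analysis Literature.Analysis.FluidPDE Literature.Analysis.UnboundedOperators
set_option linter.dupNamespace false
namespace Summit.NavierStokesRegularity.NavierStokesRegularity.Theorems.TypeILiouvilleShoreline

/-- The vorticity of a class-P slice is real-analytic on `ℝ³` (`curl = curlCLM ∘ fderiv` of an analytic slice).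
[cite: LemarieRieusset2016, Thm. 9.12 (PDF p. 260)] -/
theorem classP_curl_analyticOnNhd_slice
    {v : ℝ → EuclideanSpace ℝ (Fin 3) → EuclideanSpace ℝ (Fin 3)}
    (hc : ContinuousOn (uncurry v) (Iio 0 ×ˢ univ))
    (hK : ∃ K : ℝ, ∀ t < 0, ∀ x, ‖v t x‖ ≤ K)
    (hm : ∀ s t : ℝ, s < t → t < 0 → ∀ x,
      v t x = heatExtension (v s) (t - s) x - oseenDuhamel 1 s v v t x)
    {t : ℝ} (ht : t < 0) : AnalyticOnNhd ℝ (curl (v t)) univ :=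
  curlCLM.comp_analyticOnNhd (classP_analyticOnNhd_slice hc hK hm ht).fderiv

/-- **LOCALLY IRROTATIONAL ANYWHERE ⟹ TRIVIAL (a proved sector of (L)).**  A class-P flow whose vorticity vanishes on
ONE nonempty open set of ONE slice `t₀ < 0` is one constant vector on `(−∞,0) × ℝ³`: the analytic vorticity of the
slice vanishes identically (identity theorem), a curl-free, divergence-free, bounded `C²` field on `ℝ³` is constant
(`eq_of_curl_eq_zero_of_isDivFree_of_bounded`), and one constant slice forces a constant flow
(`classP_const_of_locallyConst_slice`). [cite: LemarieRieusset2016, Thm. 9.12; KochNadirashviliSereginSverak2009, Remark 6.1 (arXiv:0709.3599)] -/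
theorem classP_const_of_locallyIrrotational
    {v : ℝ → EuclideanSpace ℝ (Fin 3) → EuclideanSpace ℝ (Fin 3)}
    (hc : ContinuousOn (uncurry v) (Iio 0 ×ˢ univ))
    (hK : ∃ K : ℝ, ∀ t < 0, ∀ x, ‖v t x‖ ≤ K)
    (hd : ∀ t < 0, IsWeaklyDivFree (v t))
    (hm : ∀ s t : ℝ, s < t → t < 0 → ∀ x,
      v t x = heatExtension (v s) (t - s) x - oseenDuhamel 1 s v v t x)
    {t₀ : ℝ} (ht₀ : t₀ < 0) {U : Set (EuclideanSpace ℝ (Fin 3))} (hUo : IsOpen U) (hUne : U.Nonempty)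
    (h : ∀ x ∈ U, curl (v t₀) x = 0) :
    ∃ b : EuclideanSpace ℝ (Fin 3), ∀ t < 0, ∀ x, v t x = b := by
  obtain ⟨K, hKb⟩ := hK
  -- the vorticity of the slice vanishes identically
  have hcurl : ∀ x, curl (v t₀) x = 0 :=
    const_of_analyticOnNhd_of_locallyConst (classP_curl_analyticOnNhd_slice hc ⟨K, hKb⟩ hm ht₀) hUo hUne h
  -- the slice is `C²`, classically divergence free and bounded, hence constant
  obtain ⟨hsm', -⟩ := smooth_and_bounds_of_bounded_ancient_oseenMild hc hd hm hKb
  have hsm : IsSmoothSpaceTimeOn (Iio 0) v := hsm'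
  have h2 : ContDiff ℝ 2 (v t₀) := (hsm.contDiff_slice (mem_Iio.2 ht₀)).of_le (by norm_cast)
  have hdiv : VectorCalculus.IsDivFree (v t₀) := (hd t₀ ht₀).isDivFree_of_contDiff (h2.of_le (by norm_num))
  have hslice : ∀ x, v t₀ x = v t₀ 0 := fun x =>
    eq_of_curl_eq_zero_of_isDivFree_of_bounded h2 hcurl hdiv (fun z => hKb t₀ ht₀ z) x 0
  exact ⟨v t₀ 0, classP_const_of_locallyConst_slice hc ⟨K, hKb⟩ hm ht₀ isOpen_univ univ_nonempty
    fun x _ => hslice x⟩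

/-- Contrapositive: **a non-constant class-P flow is ROTATIONAL EVERYWHERE** — on every slice `t < 0` and every nonempty
open set some point carries non-zero vorticity. [cite: LemarieRieusset2016, Thm. 9.12 (PDF p. 260)] -/
theorem classP_exists_curl_ne_zero_of_nonconst
    {v : ℝ → EuclideanSpace ℝ (Fin 3) → EuclideanSpace ℝ (Fin 3)}
    (hc : ContinuousOn (uncurry v) (Iio 0 ×ˢ univ))
    (hK : ∃ K : ℝ, ∀ t < 0, ∀ x, ‖v t x‖ ≤ K)
    (hd : ∀ t < 0, IsWeaklyDivFree (v t))
    (hm : ∀ s t : ℝ, s < t → t < 0 → ∀ x,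
      v t x = heatExtension (v s) (t - s) x - oseenDuhamel 1 s v v t x)
    (hnc : ¬ ∃ b : EuclideanSpace ℝ (Fin 3), ∀ t < 0, ∀ x, v t x = b) {t : ℝ} (ht : t < 0)
    {U : Set (EuclideanSpace ℝ (Fin 3))} (hUo : IsOpen U) (hUne : U.Nonempty) :
    ∃ x ∈ U, curl (v t) x ≠ 0 := by
  by_contra hcon
  push Not at hcon
  exact hnc (classP_const_of_locallyIrrotational hc hK hd hm ht hUo hUne hcon)

/-- **LOCALLY TRANSLATION-INVARIANT ANYWHERE ⟹ GLOBALLY INVARIANT ALONG THE WHOLE LINE.**  If `v t₀ (x + s•e) = v t₀ x`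
for `x` in ONE nonempty open set and all `|s| < δ` (`t₀ < 0`, `δ > 0`), then `v t (x + s•e) = v t x` for ALL `t < 0`,
ALL `s : ℝ` and all `x`: each small `s` gives a global period (`classP_spacePeriodic_of_locallyPeriodic`), and the analytic
function `s ↦ v t (x + s•e)` which is constant for `|s| < δ` is constant on `ℝ`.  Such a member is a 2½-dimensional flow
(the KNSS Theorem 5.1 wall). [cite: LemarieRieusset2016, Thm. 9.12; KochNadirashviliSereginSverak2009, Thm. 5.1 (arXiv:0709.3599)] -/
theorem classP_translationInvariant_of_locally
    {v : ℝ → EuclideanSpace ℝ (Fin 3) → EuclideanSpace ℝ (Fin 3)}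
    (hc : ContinuousOn (uncurry v) (Iio 0 ×ˢ univ))
    (hK : ∃ K : ℝ, ∀ t < 0, ∀ x, ‖v t x‖ ≤ K)
    (hm : ∀ s t : ℝ, s < t → t < 0 → ∀ x,
      v t x = heatExtension (v s) (t - s) x - oseenDuhamel 1 s v v t x)
    (e : EuclideanSpace ℝ (Fin 3)) {t₀ δ : ℝ} (ht₀ : t₀ < 0) (hδ : 0 < δ)
    {U : Set (EuclideanSpace ℝ (Fin 3))} (hUo : IsOpen U) (hUne : U.Nonempty)
    (h : ∀ s ∈ Ioo (-δ) δ, ∀ x ∈ U, v t₀ (x + s • e) = v t₀ x) :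
    ∀ t < 0, ∀ s : ℝ, ∀ x, v t (x + s • e) = v t x := by
  -- small translations are global symmetries
  have hsmall : ∀ s ∈ Ioo (-δ) δ, ∀ t < 0, ∀ x, v t (x + s • e) = v t x := fun s hs =>
    classP_spacePeriodic_of_locallyPeriodic hc hK hm (s • e) ht₀ hUo hUne (h s hs)
  intro t ht s x
  -- the analytic function `σ ↦ v t (x + σ • e)` is constant near `0`, hence on `ℝ`
  have hline : AnalyticOnNhd ℝ (fun σ : ℝ => x + σ • e) univ := fun σ _ =>
    analyticAt_const.add (analyticAt_id.smul analyticAt_const)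
  have han : AnalyticOnNhd ℝ (fun σ : ℝ => v t (x + σ • e)) univ := fun σ _ =>
    (classP_analyticOnNhd_slice hc hK hm ht _ (mem_univ _)).comp (hline σ (mem_univ σ))
  have hev : (fun σ : ℝ => v t (x + σ • e)) =ᶠ[𝓝 (0 : ℝ)] fun _ => v t x := by
    filter_upwards [isOpen_Ioo.mem_nhds (show (0 : ℝ) ∈ Ioo (-δ) δ from ⟨by linarith, hδ⟩)] with σ hσ
      using hsmall σ hσ t ht x
  exact han.eqOn_of_preconnected_of_eventuallyEq analyticOnNhd_const isPreconnected_univ (mem_univ 0) hev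
    (mem_univ s)

/-- **COMPACTLY SUPPORTED (or exterior-vanishing) VORTICITY AT ONE TIME ⟹ TRIVIAL.**  A class-P flow whose vorticity at
ONE time `t₀ < 0` vanishes outside some ball — `curl v(t₀, x) = 0` for `R < ‖x‖` — is one constant vector (the exterior
of a ball is a nonempty open set; `classP_const_of_locallyIrrotational`).  In particular no non-constant member of
print's class has compactly supported vorticity on any slice. [cite: LemarieRieusset2016, Thm. 9.12 (PDF p. 260)] -/
theorem classP_const_of_curl_eq_zero_outside_ball
    {v : ℝ → EuclideanSpace ℝ (Fin 3) → EuclideanSpace ℝ (Fin 3)}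
    (hc : ContinuousOn (uncurry v) (Iio 0 ×ˢ univ))
    (hK : ∃ K : ℝ, ∀ t < 0, ∀ x, ‖v t x‖ ≤ K)
    (hd : ∀ t < 0, IsWeaklyDivFree (v t))
    (hm : ∀ s t : ℝ, s < t → t < 0 → ∀ x,
      v t x = heatExtension (v s) (t - s) x - oseenDuhamel 1 s v v t x)
    {t₀ : ℝ} (ht₀ : t₀ < 0) {R : ℝ} (h : ∀ x : EuclideanSpace ℝ (Fin 3), R < ‖x‖ → curl (v t₀) x = 0) :
    ∃ b : EuclideanSpace ℝ (Fin 3), ∀ t < 0, ∀ x, v t x = b := by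
  -- a point outside the ball: `z = (|R| + 1) • e` for a unit coordinate vector `e`
  set e : EuclideanSpace ℝ (Fin 3) := EuclideanSpace.single 0 (1 : ℝ) with he
  have he1 : ‖e‖ = 1 := by rw [he, EuclideanSpace.single, PiLp.norm_single, norm_one]
  set z : EuclideanSpace ℝ (Fin 3) := (|R| + 1) • e with hz
  have hzR : R < ‖z‖ := by
    rw [hz, norm_smul, he1, mul_one, Real.norm_eq_abs, abs_of_pos (by positivity)]
    linarith [le_abs_self R]
  have hopen : IsOpen {x : EuclideanSpace ℝ (Fin 3) | R < ‖x‖} := isOpen_lt continuous_const continuous_norm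
  exact classP_const_of_locallyIrrotational hc hK hd hm ht₀ hopen ⟨z, hzR⟩ fun x hx => h x hx

end Summit.NavierStokesRegularity.NavierStokesRegularity.Theorems.TypeILiouvilleShoreline

end
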